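import Literature.Geometry.Lorentzian.KerrIngoingCoordChart
import Literature.Geometry.Lorentzian.SchwarzschildKerrSchildComponents
import HarnessLib

/-!
# The Kerr metric in ingoing Kerr coordinates `(t*, r, μ, φ)`, IIb: the pull-back of the
# Kerr–Schild form along the chart

Infrastructure (all results proved) for `Kerr.isRicciFlat M a r₀` (all spins), continuing
`KerrIngoingCoordChart.lean`:

* the Gram table of the Jacobian columns `n⃗, m⃗, p⃗` of the chart `Ψ` (`inner_jacN_jacN`, …,
  `inner_spatial_jac`: `⟪n⃗,n⃗⟫ = 1`, `⟪n⃗,p⃗⟫ = −a(1−μ²)`, `⟪m⃗,m⃗⟫ = Σ/(1−μ²)`, `⟪p⃗,p⃗⟫ = (r²+a²)(1−μ²)`,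
  the others `0`);
* `Kerr.Ingoing.kerrBilin_jac` — **the pulled-back Kerr–Schild form is the rational component
  field of `KerrIngoingCoordMetric.lean`**: `g_{Ψ u}(J_u v, J_u w) = Kerr.Ingoing.bilin M a u v w`
  for `u` in the coordinate domain (Kerr 1963, eq. (1); Visser arXiv:0706.0622, (E:K1)–(E:K2)),
  from `ℓ⃗(Y_a) = n̂`, `H(Y_a) = Mr/Σ`, `r(Y_a) = r` (`KerrStarCoord.lean`), the Gram table and
  `η(v, w) = −v⁰w⁰ + ⟪v⃗, w⃗⟫` (`Kerr.minkowski_bilin_eq_spatial`, `SchwarzschildKerrSchildComponents.lean`);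
* `Kerr.Ingoing.jac_injective` — the Jacobian is injective on the coordinate domain;
* `Kerr.Ingoing.exists_chartFun_eq` — every point of `Kerr.region a r₀` off the axis `{x = y = 0}`
  is `Ψ u` for some `u` in the coordinate domain.

## References

* R. P. Kerr, Phys. Rev. Lett. 11 (1963) 237–238, eq. (1).
* M. Visser, *The Kerr spacetime: a brief introduction*, arXiv:0706.0622, §4, (E:K1)–(E:K2), (33)–(36).
* B. O'Neill, *Semi-Riemannian geometry* (1983), Ch. 3, p. 55.
-/

noncomputable section

set_option maxSynthPendingDepth 3

open Set Function Real
open scoped InnerProductSpace Topology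

namespace Literature.Geometry.Lorentzian

namespace Kerr

namespace Ingoing

variable {M a r₀ : ℝ} {u : E4}

/-! ### The Gram table of the Jacobian columns -/

/-- `⟪p, q⟫ = p₀q₀ + p₁q₁ + p₂q₂` on `E3`. [folklore] -/
theorem inner_e3 (p q : E3) : ⟪p, q⟫_ℝ = p 0 * q 0 + p 1 * q 1 + p 2 * q 2 := by
  simp only [PiLp.inner_apply, RCLike.inner_apply, conj_trivial, Fin.sum_univ_three]
  ring

section Gram

variable (hu : u ∈ coordDomain r₀)
include hu

/-- `⟪n⃗, n⃗⟫ = 1`. [folklore] -/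
theorem inner_jacN_jacN : ⟪jacN u, jacN u⟫_ℝ = 1 := by
  have hs := sroot_sq hu
  have hc := cos_sq_add_sin_sq (u 3)
  rw [sinSq] at hs
  rw [inner_e3]
  simp only [jacN, Fin.isValue, Matrix.cons_val_zero, Matrix.cons_val_one, Matrix.cons_val,
    PiLp.toLp_apply] -- components
  linear_combination sroot u ^ 2 * hc + hs

/-- `⟪n⃗, m⃗⟫ = 0`. [folklore] -/
theorem inner_jacN_jacM : ⟪jacN u, jacM a u⟫_ℝ = 0 := by
  have hs0 := (sroot_pos hu).ne'
  have hc := cos_sq_add_sin_sq (u 3)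
  rw [inner_e3]
  simp only [jacN, jacM, Fin.isValue, Matrix.cons_val_zero, Matrix.cons_val_one, Matrix.cons_val,
    PiLp.toLp_apply]
  field_simp
  linear_combination (-(u 2 * u 1)) * hc

/-- `⟪n⃗, p⃗⟫ = −a(1 − μ²)` (`= c₁₃`). [folklore] -/
theorem inner_jacN_jacP : ⟪jacN u, jacP a u⟫_ℝ = -(a * sinSq u) := by
  have hs := sroot_sq hu
  have hc := cos_sq_add_sin_sq (u 3)
  rw [inner_e3]
  simp only [jacN, jacP, Fin.isValue, Matrix.cons_val_zero, Matrix.cons_val_one, Matrix.cons_val,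
    PiLp.toLp_apply]
  linear_combination (-(a * sroot u ^ 2)) * hc - a * hs

/-- `⟪m⃗, m⃗⟫ = Σ/(1 − μ²)` (`= c₂₂`). [folklore] -/
theorem inner_jacM_jacM : ⟪jacM a u, jacM a u⟫_ℝ = sigma a u / sinSq u := by
  have hs := sroot_sq hu
  have hs0 := (sroot_pos hu).ne'
  have hP := sinSq_ne_zero hu
  have hc := cos_sq_add_sin_sq (u 3)
  rw [inner_e3, ← hs]
  simp only [jacM, Fin.isValue, Matrix.cons_val_zero, Matrix.cons_val_one, Matrix.cons_val,
    PiLp.toLp_apply, sigma]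
  rw [sinSq] at hs
  field_simp
  linear_combination (u 2 ^ 2 * (u 1 ^ 2 + a ^ 2)) * hc + u 1 ^ 2 * hs

omit hu in
/-- `⟪m⃗, p⃗⟫ = 0`. [folklore] -/
theorem inner_jacM_jacP : ⟪jacM a u, jacP a u⟫_ℝ = 0 := by
  rw [inner_e3]
  simp only [jacM, jacP, Fin.isValue, Matrix.cons_val_zero, Matrix.cons_val_one, Matrix.cons_val,
    PiLp.toLp_apply]
  ring

/-- `⟪p⃗, p⃗⟫ = (r² + a²)(1 − μ²)`. [folklore] -/
theorem inner_jacP_jacP : ⟪jacP a u, jacP a u⟫_ℝ = (u 1 ^ 2 + a ^ 2) * sinSq u := by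
  have hs := sroot_sq hu
  have hc := cos_sq_add_sin_sq (u 3)
  rw [inner_e3, ← hs]
  simp only [jacP, Fin.isValue, Matrix.cons_val_zero, Matrix.cons_val_one, Matrix.cons_val,
    PiLp.toLp_apply]
  linear_combination (sroot u ^ 2 * (u 1 ^ 2 + a ^ 2)) * hc

/-- **The flat metric on the Jacobian**: `⟪(J v)⃗, (J w)⃗⟫` expanded with the Gram table. [folklore] -/
theorem inner_spatial_jac (v w : E4) :
    ⟪E4.spatial (jac a u v), E4.spatial (jac a u w)⟫_ℝ =
      v 1 * w 1 + -(a * sinSq u) * (v 1 * w 3 + v 3 * w 1) + sigma a u / sinSq u * (v 2 * w 2) +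
        (u 1 ^ 2 + a ^ 2) * sinSq u * (v 3 * w 3) := by
  have h11 := inner_jacN_jacN hu
  have h12 := inner_jacN_jacM (a := a) hu
  have h13 := inner_jacN_jacP (a := a) hu
  have h22 := inner_jacM_jacM (a := a) hu
  have h23 := inner_jacM_jacP (a := a) (u := u)
  have h33 := inner_jacP_jacP (a := a) hu
  have h21 : ⟪jacM a u, jacN u⟫_ℝ = 0 := by rw [real_inner_comm, h12]
  have h31 : ⟪jacP a u, jacN u⟫_ℝ = -(a * sinSq u) := by rw [real_inner_comm, h13]
  have h32 : ⟪jacP a u, jacM a u⟫_ℝ = 0 := by rw [real_inner_comm, h23]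
  rw [spatial_jac, spatial_jac]
  simp only [inner_add_left, inner_add_right, real_inner_smul_left, real_inner_smul_right, h11, h12,
    h13, h21, h22, h23, h31, h32, h33]
  ring

end Gram

/-! ### The Kerr–Schild data at the image point -/

/-- `ℓ(v) = v⁰ + ⟪ℓ⃗, v⃗⟫` (`ℓ₀ = 1`). Visser arXiv:0706.0622, (34). [cite: arXiv07060622, (34)] -/
theorem nullCovector_eq_inner (a : ℝ) (x v : E4) :
    nullCovector a x v = v 0 + ⟪nullSpatial a x, E4.spatial v⟫_ℝ := by
  rw [nullCovector, E4.covector_apply, Fin.sum_univ_four, inner_e3]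
  simp only [nullSpatial_apply, E4.spatial_apply, Fin.succ_zero_eq_one, Fin.succ_one_eq_two,
    Fin.isValue]
  have h0 : nullCovectorFun a x 0 = 1 := rfl
  have h3 : (2 : Fin 3).succ = (3 : Fin 4) := rfl
  rw [h0, h3]
  ring

/-- The spatial null vector does not depend on `t*`. [folklore] -/
theorem nullSpatial_ofTimeSpace (a t : ℝ) (y : E3) :
    nullSpatial a (E4.ofTimeSpace t y) = nullSpatial a (E4.ofTimeSpace 0 y) := by
  have h1 : ∀ t : ℝ, (E4.ofTimeSpace t y) 1 = y 0 := fun t ↦ E4.ofTimeSpace_apply_succ t y 0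
  have h2 : ∀ t : ℝ, (E4.ofTimeSpace t y) 2 = y 1 := fun t ↦ E4.ofTimeSpace_apply_succ t y 1
  have h3 : ∀ t : ℝ, (E4.ofTimeSpace t y) 3 = y 2 := fun t ↦ E4.ofTimeSpace_apply_succ t y 2
  ext i
  rw [nullSpatial_apply, nullSpatial_apply]
  fin_cases i <;>
    simp [nullCovectorFun, radius_ofTimeSpace, h1, h2, h3]

/-- **`ℓ⃗ = n⃗` at the image point**: `ℓ⃗(Ψ u) = n̂(arccos μ, φ) = jacN u` on the coordinate domain
(`nullSpatial_kerrStar`). [cite: arXiv07060622, (34) and §4] -/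
theorem nullSpatial_chartFun (hu : u ∈ coordDomain r₀) : nullSpatial a (chartFun a r₀ u) = jacN u := by
  rw [chartFun_eq hu, nullSpatial_ofTimeSpace, nullSpatial_kerrStar a (radial_pos hu)]
  ext i
  fin_cases i
  · simp [jacN, sin_arccos_eq]
  · simp [jacN, sin_arccos_eq]
  · simp [jacN, cos_arccos_eq hu]

/-- **`H = Mr/Σ` at the image point**: `H(Ψ u) = Kerr.Ingoing.scalarH M a u`. [cite: arXiv07060622, (33)] -/
theorem scalarH_chartFun (hu : u ∈ coordDomain r₀) : Kerr.scalarH M a (chartFun a r₀ u) = scalarH M a u := by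
  have hr := radial_pos hu
  have hr' : 0 < radius a (E4.ofTimeSpace 0 (kerrStar a (u 1) (arccos (u 2)) (u 3))) := by
    rwa [radius_kerrStar a hr]
  rw [chartFun_eq hu, scalarH_ofTimeSpace_eq _ hr', radius_kerrStar a hr, blSigma_kerrStar a hr,
    cos_arccos_eq hu, scalarH, sigma]

/-- `ℓ(J v) = v⁰ + v¹ − a(1 − μ²) v³` at the image point. [cite: arXiv07060622, (E:K1)] -/
theorem nullCovector_jac (hu : u ∈ coordDomain r₀) (v : E4) :
    nullCovector a (chartFun a r₀ u) (jac a u v) = v 0 + v 1 - a * sinSq u * v 3 := by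
  have h11 := inner_jacN_jacN hu
  have h12 := inner_jacN_jacM (a := a) hu
  have h13 := inner_jacN_jacP (a := a) hu
  rw [nullCovector_eq_inner, nullSpatial_chartFun hu, jac_apply_zero, spatial_jac]
  simp only [inner_add_right, real_inner_smul_right, h11, h12, h13]
  ring

/-- **The pulled-back Kerr–Schild form is the rational component field**:
`g_{Ψ u}(J_u v, J_u w) = Kerr.Ingoing.bilin M a u v w` for `u` in the coordinate domain — the Kerr
metric in the ingoing Kerr coordinates `(t*, r, μ, φ)`. Kerr 1963, eq. (1); Visser arXiv:0706.0622,
(E:K1)–(E:K2). [cite: arXiv07060622, (E:K1)–(E:K2)] -/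
theorem kerrBilin_jac (hu : u ∈ coordDomain r₀) (v w : E4) :
    Kerr.bilin M a (chartFun a r₀ u) (jac a u v) (jac a u w) = bilin M a u v w := by
  rw [Kerr.bilin_apply, scalarH_chartFun hu, nullCovector_jac hu, nullCovector_jac hu,
    Kerr.minkowski_bilin_eq_spatial, inner_spatial_jac hu, jac_apply_zero, jac_apply_zero,
    bilin_apply]
  simp only [c13, c22, c33, h00, h03]
  ring

/-! ### The Jacobian is injective on the coordinate domain -/

/-- **`J_u` is injective** for `u` in the coordinate domain: `g_{Ψu}(J v, J ·)` with `M = 0` is the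
flat form in Kerr coordinates, which is nondegenerate (`det = −Σ²`). [folklore] -/
theorem jac_injective (hu : u ∈ coordDomain r₀) : Function.Injective (jac a u) := by
  have hP := sinSq_ne_zero hu
  have hS := sigma_ne_zero (a := a) hu
  refine (injective_iff_map_eq_zero _).2 fun v hv ↦ ?_
  have key : ∀ w, bilin 0 a u v w = 0 := fun w ↦ by
    rw [← kerrBilin_jac hu, hv, map_zero, zero_apply]
  have e0 := key (E4.basisVector 0)
  have e1 := key (E4.basisVector 1)
  have e2 := key (E4.basisVector 2)
  have e3 := key (E4.basisVector 3)
  simp only [bilin_apply, h00, h03, c33, c13, c22, scalarH, zero_mul, zero_div, mul_zero,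
    add_zero, E4.basisVector, PiLp.single_apply, Fin.isValue, if_true, Fin.reduceEq,
    if_false, mul_one, mul_zero, zero_add, add_zero, neg_zero] at e0 e1 e2 e3
  have h0 : v 0 = 0 := by linarith
  have h2 : v 2 = 0 := by
    rcases mul_eq_zero.1 e2 with h | h
    · exact absurd h (div_ne_zero hS hP)
    · exact h
  -- the `(1,3)` block has determinant `(1 − μ²) Σ ≠ 0`
  have h3 : v 3 = 0 := by
    have hdet : ((u 1 ^ 2 + a ^ 2) * sinSq u - a * sinSq u * (a * sinSq u)) * v 3 = 0 := by
      linear_combination e3 - (-(a * sinSq u)) * e1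
    have hne : (u 1 ^ 2 + a ^ 2) * sinSq u - a * sinSq u * (a * sinSq u) ≠ 0 := by
      have : (u 1 ^ 2 + a ^ 2) * sinSq u - a * sinSq u * (a * sinSq u) = sinSq u * sigma a u := by
        simp only [sigma, sinSq]; ring
      rw [this]; exact mul_ne_zero hP hS
    exact (mul_eq_zero.1 hdet).resolve_left hne
  have h1 : v 1 = 0 := by rw [h3] at e1; linarith
  ext i
  fin_cases i <;> simp [h0, h1, h2, h3]

/-! ### Every off-axis point is in the image of the coordinate domain -/

/-- **Surjectivity off the axis**: a point of `Kerr.region a r₀` with `(x, y) ≠ (0, 0)` is `Ψ u`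
for some `u` in the coordinate domain (`u = (t*, r, cos θ, φ)` with `(θ, φ)` from
`Kerr.exists_kerrStar_eq`). [cite: arXiv07060622, §4] -/
theorem exists_chartFun_eq {x : E4} (hx : x ∈ region a r₀) (hax : x 1 ≠ 0 ∨ x 2 ≠ 0) :
    ∃ u ∈ coordDomain r₀, chartFun a r₀ u = x := by
  set y : E3 := E4.spatial x with hy
  have hxeq : E4.ofTimeSpace (x 0) y = x := E4.ofTimeSpace_time_spatial x
  have hr0 : radius a (E4.ofTimeSpace 0 y) = radius a x := radius_ofTimeSpace_spatial a x
  have hr : 0 < radius a (E4.ofTimeSpace 0 y) := by rw [hr0]; exact radius_pos_of_mem_region hx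
  have hy' : y 0 ≠ 0 ∨ y 1 ≠ 0 := by simpa [hy, E4.spatial_apply] using hax
  obtain ⟨θ, hθ, φ, hk⟩ := exists_kerrStar_eq hr hy'
  have hcos : -1 < cos θ ∧ cos θ < 1 := by
    have hs : 0 < sin θ := sin_pos_of_pos_of_lt_pi hθ.1 hθ.2
    have h2 : cos θ ^ 2 < 1 := by nlinarith [sin_sq_add_cos_sq θ]
    exact abs_lt.mp ((sq_lt_one_iff_abs_lt_one _).mp h2)
  set u : E4 := !₂[x 0, radius a x, cos θ, φ] with hu_def
  have hu0 : u 0 = x 0 := rfl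
  have hu1 : u 1 = radius a x := rfl
  have hu2 : u 2 = cos θ := rfl
  have hu3 : u 3 = φ := rfl
  have hu : u ∈ coordDomain r₀ := by
    rw [mem_coordDomain, hu1, hu2]
    exact ⟨hx, hcos⟩
  refine ⟨u, hu, ?_⟩
  rw [chartFun_eq hu, hu0, hu1, hu2, hu3, arccos_cos hθ.1.le hθ.2.le, ← hr0, hk, hxeq]
end Ingoing

end Kerr

end Literature.Geometry.Lorentzian

end
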